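import Summits.BirchSwinnertonDyer.BirchSwinnertonDyer.Theorems.ErratumRoadFiveShimuraKolyvaginOrderBoundInertShiftDescent
import HarnessLib

/-!
# Route `ErratumRoadFive`, crux `ShimuraKolyvaginOrderBoundInertFromFive` (item
# stmt-BirchSwinnertonDyer-19718) — the MACHINE half of the level shift, III: leaf (A) from points and the
# conductor-keyed point-level entry, with Kolyvagin primes of DEPTH `M + k`

Cell `bsd-stepL`, seat `bsd-stepL-shim-p1` (prover g8), HELPER for the crux
`Summit.BirchSwinnertonDyer.BirchSwinnertonDyer.Theses.ErratumRoadFive.ShimuraKolyvaginOrderBoundInertFromFive`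
(`--supports stmt-BirchSwinnertonDyer-19718 --as helper`; K2 route `route-BirchSwinnertonDyer-ErratumRoadFive`
rev 19; skeleton v2 df9d5864b1b31f6b, stub S1 `stub_inert_unitIndex`). Sequel of
`…InertShiftCebotarev` (McCallum's Cor. 3.2 one level deeper) and `…InertShiftDescent` (the descent).
Planner rulings g27 21:38Z ∕ g28 00:20:29Z: S1's road is the LEVEL SHIFT — the Euler system is read at Kolyvagin primes of depth `M + k` while
Kolyvagin's classes stay at level `p^M` (McCallum 1991 Lemma 4.6; Kolyvagin, Math. Ann. 291 §2; Howard 2004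
Thm. 3.2.2), so that the bad-place Selmer clause needs NO Tamagawa clause (shim3a g2 p477215).

## What is proved (theorems only; no `def`, no named fact, no `sorry`)

x11b3's machine (`Literature/…/HeegnerPointsKolyvaginPrimary{Descent,Leaves,Exponent,Points}Proofs`)
asks its two leaves at EVERY Kolyvagin prime of level `M` (`IsKolyvaginPrime N W K p ℓ ∧
FrobEqFrobInfty W K (p^M) ℓ`). This file re-runs it with the predicate of Kolyvagin primes REPLACED by
the depth-`(M+k)` one (`… ∧ FrobEqFrobInfty W K (p^(M+k)) ℓ`), every other token unchanged:

(File II `…InertShiftDescent`: `exists_hypothesesM_of_leavesM_shift`,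
`pow_smul_sha_primary_eq_zero_at_of_leavesM_shift`.)
* §3 `exists_leafA_of_points_shift` — leaf (A) from points, for the depth-`(M+k)` levels.
* §4 `hdual_shift_of_kolyvaginReciprocityM_of_conductorNorm`,
  **`pow_smul_sha_primary_eq_zero_at_of_pointsM_shift_of_reciprocityM_of_conductorNorm`** and its case
  `m = 0` **`sha_primary_eq_zero_at_of_pointsM_shift_of_reciprocityM_of_not_dvd_of_conductorNorm`** —
  the conductor-keyed point-level entry of `…InertMachineEntry` §3 (p470900) with the point-level leaf
  (A′) `hpoints` asked only for the square-free products of depth-`(M+k)` Kolyvagin primes.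

HONEST FRAMING: TOOLS for S1's level-shift road; S1 ∕ S2 and item 19718 stay OPEN (the Shimura carrier
`hpointsR` — CM points on `X_{N⁺,N⁻}` over ring class fields with their norm ∕ congruence ∕ conjugation
relations, BD96 §2, Nekovář 2007 §4 — is printed, not in the tree); BSD is not proved by any of this; no
census number moves. `p`-generic (`p` odd, `ρ̄_{E,p}` onto): serves 19899 ∕ KOLY verbatim.
[cite: McCallumLMS1991, §1 Theorem (Kolyvagin), §3 Cor. 3.2, §4 (4)–(6), Lemma 4.3, Prop. 4.4, Lemma 4.6, §5 Lemmas 5.1, 5.3]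
[cite: GrossLMS1991, §1 Thm. 1.3 (2), Prop. 2.1 (2), §§3–5, §10] [cite: Howard2004Duke, Thm. 3.2.2 (proof)]
presearch: as file I (SHIM3A-MEMO §1, referee g34; corpus + galaxy); `lean search 'of_leavesM_shift|pointsM_shift'` → none.
-/

noncomputable section

open scoped Classical

set_option linter.dupNamespace false

namespace Summit.BirchSwinnertonDyer.BirchSwinnertonDyer.Theorems

open WeierstrassCurve NumberField IsDedekindDomain Field
  Literature.NumberTheory.EllipticCurves Literature.NumberTheory.GaloisRepresentations
  Literature.NumberTheory.EllipticCurves.KolyvaginDescent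

universe u

section Leaves

variable {N : ℕ} {W : WeierstrassCurve ℚ} {K : Type u} [Field K] [NumberField K]

/-! ### §3 Leaf (A) from points, at the depth-`(M+k)` levels -/

/-- **Leaf (A) from points at the depth-`(M+k)` levels** — x11b3's `KolyvaginDescent.exists_leafA_of_points`
VERBATIM with the Kolyvagin-level predicate replaced by the depth-`(M+k)` one: define `c_M(m)` as the
Kolyvagin class of `P_m`; then `c_M(1) = δ_M y_K` (McCallum (6)) and the sign relation (Gross Prop. 5.4 (2)
from (1)) are theorems, the local clauses pass through. [cite: McCallumLMS1991, §4 (4)–(6), Lemma 4.1]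
[cite: GrossLMS1991, §4 (4.1), (4.4), Prop. 5.4] -/
theorem exists_leafA_of_points_shift {P : (W.baseChange K).toAffine.Point} {p M : ℕ} (k : ℕ)
    (hdiv : ∀ Q : geomPoints (W.baseChange K), ∃ R, ((p ^ M : ℕ) : ℤ) • R = Q)
    (c : K ≃ₐ[ℚ] K) {τ : AlgebraicClosure K ≃+* AlgebraicClosure K} (hτ : IsLiftOfAut c τ)
    (ε : ℤ) (A : ℕ → AddSubgroup (geomPoints (W.baseChange K)))
    (hA : ∀ m, KolyvaginCocycle.IsAdmissible (Field.absoluteGaloisGroup K) (A m) ((p ^ M : ℕ) : ℤ))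
    (hAτ : ∀ m, ∀ a ∈ A m, hτ.pointsMap W a ∈ A m)
    (Pt : ℕ → geomPoints (W.baseChange K))
    (hPt : ∀ m, Pt m ∈
      KolyvaginCocycle.invPoints (Field.absoluteGaloisGroup K) (A m) ((p ^ M : ℕ) : ℤ))
    (hPt1 : Pt 1 = toGeomPoints (W.baseChange K) P)
    (h541 : ∀ m : ℕ, Squarefree m →
      (∀ q ∈ m.primeFactors, IsKolyvaginPrime N W K p q ∧ FrobEqFrobInfty W K (p ^ (M + k)) q) →
      ∃ B ∈ A m, hτ.pointsMap W (Pt m) =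
        (ε * (-1) ^ m.primeFactors.card) • Pt m + ((p ^ M : ℕ) : ℤ) • B)
    (hloc : ∀ m : ℕ, Squarefree m →
      (∀ q ∈ m.primeFactors, IsKolyvaginPrime N W K p q ∧ FrobEqFrobInfty W K (p ^ (M + k)) q) →
      ∀ v : HeightOneSpectrum (𝓞 K), (m : 𝓞 K) ∉ v.asIdeal →
        kolyvaginClass (W.baseChange K) _ hdiv (hA m) (Pt m) (hPt m) ∈
          selmerLocalKer (W.baseChange K) (v.adicCompletion K) ((p ^ M : ℕ) : ℤ))
    (h44 : ∀ m : ℕ, Squarefree m →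
      (∀ q ∈ m.primeFactors, IsKolyvaginPrime N W K p q ∧ FrobEqFrobInfty W K (p ^ (M + k)) q) →
      ∀ ℓ : ℕ, ℓ.Prime → ℓ ∣ m → ∀ v : HeightOneSpectrum (𝓞 K), (ℓ : 𝓞 K) ∈ v.asIdeal →
        ∀ a : ℕ, (((p : ℤ) ^ a) • kolyvaginClass (W.baseChange K) _ hdiv (hA m) (Pt m) (hPt m) ∈
            selmerLocalKer (W.baseChange K) (v.adicCompletion K) ((p ^ M : ℕ) : ℤ) ↔
          ((p : ℤ) ^ a) • kolyvaginClass (W.baseChange K) _ hdiv (hA (m / ℓ)) (Pt (m / ℓ))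
              (hPt (m / ℓ)) ∈
            (W.baseChange K).torsionLocalKer (v.adicCompletion K) ((p ^ M : ℕ) : ℤ))) :
    ∃ cl : ℕ → galH1Torsion (W.baseChange K) ((p ^ M : ℕ) : ℤ),
      cl 1 = kummerMapTorsion (W.baseChange K) _ hdiv P ∧
      (∀ m : ℕ, Squarefree m →
        (∀ q ∈ m.primeFactors, IsKolyvaginPrime N W K p q ∧ FrobEqFrobInfty W K (p ^ (M + k)) q) →
        conjAct W c _ (cl m) = (ε * (-1) ^ m.primeFactors.card) • cl m ∧
        (∀ v : HeightOneSpectrum (𝓞 K), (m : 𝓞 K) ∉ v.asIdeal →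
          cl m ∈ selmerLocalKer (W.baseChange K) (v.adicCompletion K) ((p ^ M : ℕ) : ℤ)) ∧
        (∀ ℓ : ℕ, ℓ.Prime → ℓ ∣ m → ∀ v : HeightOneSpectrum (𝓞 K), (ℓ : 𝓞 K) ∈ v.asIdeal →
          ∀ a : ℕ, (((p : ℤ) ^ a) • cl m ∈
              selmerLocalKer (W.baseChange K) (v.adicCompletion K) ((p ^ M : ℕ) : ℤ) ↔
            ((p : ℤ) ^ a) • cl (m / ℓ) ∈
              (W.baseChange K).torsionLocalKer (v.adicCompletion K) ((p ^ M : ℕ) : ℤ)))) := by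
  -- adapted from x11b3's `KolyvaginDescent.exists_leafA_of_points`
  refine ⟨fun m ↦ kolyvaginClass (W.baseChange K) _ hdiv (hA m) (Pt m) (hPt m), ?_, ?_⟩
  · have h1 : toGeomPoints (W.baseChange K) P ∈
        KolyvaginCocycle.invPoints (Field.absoluteGaloisGroup K) (A 1) ((p ^ M : ℕ) : ℤ) := by
      rw [← hPt1]; exact hPt 1
    change kolyvaginClass (W.baseChange K) _ hdiv (hA 1) (Pt 1) (hPt 1) = _
    rw [kolyvaginClass_congr_point (hA 1) (hP' := h1) hPt1]
    exact kolyvaginClass_toGeomPoints (hA 1) P h1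
  · intro m hm hkol
    refine ⟨?_, hloc m hm hkol, h44 m hm hkol⟩
    exact conjAct_kolyvaginClass_eq_smul W hτ (hA m) (hAτ m) (hPt m) _ (h541 m hm hkol)

end Leaves

/-! ### §4 The conductor-keyed point-level entry with depth-`(M+k)` Kolyvagin primes -/

section Entry

variable {K : Type} [Field K] [NumberField K]

/-- **Leaf (B) at the depth-`(M+k)` primes from Kolyvagin reciprocity (R)_M, keyed on the conductor** —
`…InertMachineEntry`'s `hdual_of_kolyvaginReciprocityM_of_conductorNorm` restricted to the Kolyvagin
primes with `Frob(ℓ) = Frob(∞)` on `E[p^{M+k}]` (which implies the same on `E[p^M]`,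
`FrobEqFrobInfty.of_dvd`). [cite: McCallumLMS1991, §5 Lemma 5.3, §2 Prop. 2.2] -/
theorem hdual_shift_of_kolyvaginReciprocityM_of_conductorNorm {N : ℕ} [NeZero N]
    (W : WeierstrassCurve ℚ) [W.IsElliptic] (hN : W.conductorNorm ℤ = N)
    (hK : IsImaginaryQuadratic K) {p : ℕ} (hp : p.Prime) (hp2 : p ≠ 2) {M : ℕ} (hM : 1 ≤ M) (k : ℕ)
    {c : K ≃ₐ[ℚ] K} (hc : c ≠ 1)
    (hR : ∀ {ℓ : ℕ} (hℓ : IsKolyvaginPrime N W K p ℓ), FrobEqFrobInfty W K (p ^ M) ℓ →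
      ∃ (A : Type) (_ : AddCommGroup A)
        (e : geomTorsion (W.baseChange K) ((p ^ M : ℕ) : ℤ) →+
          geomTorsion (W.baseChange K) ((p ^ M : ℕ) : ℤ) →+ A),
        (∀ x, e x x = 0) ∧ (∀ x, (∀ y, e x y = 0) → x = 0) ∧
        ∀ s ∈ selmerGroup (W.baseChange K) ((p ^ M : ℕ) : ℤ),
          ∀ c' : galH1Torsion (W.baseChange K) ((p ^ M : ℕ) : ℤ),
          (∀ v : HeightOneSpectrum (𝓞 K), (ℓ : 𝓞 K) ∉ v.asIdeal →
            c' ∈ selmerLocalKer (W.baseChange K) (v.adicCompletion K) ((p ^ M : ℕ) : ℤ)) →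
          (∀ w : InfinitePlace K,
            c' ∈ selmerLocalKer (W.baseChange K) w.Completion ((p ^ M : ℕ) : ℤ)) →
          ∀ 𝔔 ∈ hℓ.place.primesAbove, ∀ F : absoluteGaloisGroup K, IsArithFrobAt (𝓞 K) F 𝔔 →
            F ∈ torsionFixing (W.baseChange K) ((p ^ M : ℕ) : ℤ) →
            ∀ σ ∈ 𝔔.inertia (absoluteGaloisGroup K),
            e (h1Eval (W.baseChange K) ((p ^ M : ℕ) : ℤ) s F)
              (h1Eval (W.baseChange K) ((p ^ M : ℕ) : ℤ) c' σ) = 0) :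
    ∀ ℓ : ℕ, IsKolyvaginPrime N W K p ℓ ∧ FrobEqFrobInfty W K (p ^ (M + k)) ℓ →
      ∀ ν : ℤ, (ν = 1 ∨ ν = -1) → ∀ d : galH1Torsion (W.baseChange K) ((p ^ M : ℕ) : ℤ),
      conjAct W c _ d = ν • d →
      (∀ v : HeightOneSpectrum (𝓞 K), (ℓ : 𝓞 K) ∉ v.asIdeal →
        d ∈ selmerLocalKer (W.baseChange K) (v.adicCompletion K) ((p ^ M : ℕ) : ℤ)) →
      (∀ w : InfinitePlace K,
        d ∈ selmerLocalKer (W.baseChange K) w.Completion ((p ^ M : ℕ) : ℤ)) →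
      ∀ s ∈ selmerGroup (W.baseChange K) ((p ^ M : ℕ) : ℤ), conjAct W c _ s = ν • s →
      ∀ a : ℕ, a < M → ∀ v : HeightOneSpectrum (𝓞 K), (ℓ : 𝓞 K) ∈ v.asIdeal →
        ((p : ℤ) ^ a) • d ∉
          selmerLocalKer (W.baseChange K) (v.adicCompletion K) ((p ^ M : ℕ) : ℤ) →
        ((p : ℤ) ^ (M - 1 - a)) • s ∈
          (W.baseChange K).torsionLocalKer (v.adicCompletion K) ((p ^ M : ℕ) : ℤ) :=
  fun ℓ hℓ ↦ hdual_of_kolyvaginReciprocityM_of_conductorNorm W hN hK hp hp2 hM hc hR ℓ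
    ⟨hℓ.1, hℓ.2.of_dvd (pow_dvd_pow p (Nat.le_add_right M k))⟩

/-- **`p^{2m} · Ш(E/K)[p^∞] = 0` at one odd prime `p` with `ρ̄_{E,p}` onto, from Heegner-TYPE points
read at Kolyvagin primes of depth `M + k`, and Kolyvagin reciprocity (R)_M, keyed on the conductor** —
the conductor-keyed exponent entry of `…InertMachineEntry` §3
(`pow_smul_sha_primary_eq_zero_at_of_pointsM_of_reciprocityM_of_conductorNorm`, p470900) with the
point-level leaf (A′) `hpoints` asked ONLY for the square-free products `m` of Kolyvagin primes with
`Frob = Frob(∞)` on `E[p^{M+k}]` (`a_ℓ ≡ ℓ + 1 ≡ 0 mod p^{M+k}`, so that the supplier's `P_m` is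
invariant modulo `p^{M+k}` and its LEVEL-`p^M` class is Selmer at the bad places by the level-shift
lemma — McCallum L4.6, shim3a p477215): for every `M ≥ 1` a sign `ε`, a lift `τ` of `c`, admissible
`τ`-stable modules `A_m`, points `P_m ∈ A_m` invariant mod `p^M` with `P_1 = P`, Gross 5.4 (1), McCallum
L4.3 off `m` and P4.4 at `λ ∣ m`; plus (R)_M `hR` at the level-`M` Kolyvagin primes (supplied from
Poitou–Tate by `…InertReciprocity` §1). Conclusion: `p^{2m} · d = 0` for every `d ∈ Ш(E/K)[p^∞]` once
`p^{m+1} ∤ P` in `E(K)`. Proof: §2 with leaf (A) from §3 and leaf (B) from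
`hdual_shift_of_kolyvaginReciprocityM_of_conductorNorm`. [cite: GrossLMS1991, §1 Thm. 1.3 (2), §§3–8, §10]
[cite: McCallumLMS1991, §1 Theorem (Kolyvagin), Lemma 4.6, Lemma 5.1, §2 Prop. 2.2, §§4–5]
[cite: Howard2004Duke, Thm. 3.2.2 (proof)] -/
theorem pow_smul_sha_primary_eq_zero_at_of_pointsM_shift_of_reciprocityM_of_conductorNorm {N : ℕ}
    [NeZero N] (W : WeierstrassCurve ℚ) [W.IsElliptic] (hN : W.conductorNorm ℤ = N)
    (hK : IsImaginaryQuadratic K) {P : (W.baseChange K).toAffine.Point}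
    (hnt : ¬ IsOfFinAddOrder P) {p : ℕ} (hp : p.Prime)
    (hp2 : p ≠ 2) (hρ : W.HasSurjectiveModNGaloisRep p) {m : ℕ} (k : ℕ)
    (hm : ∀ Q : (W.baseChange K).toAffine.Point, p ^ (m + 1) • Q ≠ P)
    (hpoints : ∀ {M : ℕ} (_hM : 1 ≤ M)
      (hdiv : ∀ Q : geomPoints (W.baseChange K), ∃ R, ((p ^ M : ℕ) : ℤ) • R = Q)
      (c : K ≃ₐ[ℚ] K) (_hc : c ≠ 1),
      ∃ (ε : ℤ) (τ : AlgebraicClosure K ≃+* AlgebraicClosure K) (hτ : IsLiftOfAut c τ)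
        (A : ℕ → AddSubgroup (geomPoints (W.baseChange K)))
        (hA : ∀ m, KolyvaginCocycle.IsAdmissible (Field.absoluteGaloisGroup K) (A m)
          ((p ^ M : ℕ) : ℤ))
        (Pt : ℕ → geomPoints (W.baseChange K))
        (hPt : ∀ m, Pt m ∈
          KolyvaginCocycle.invPoints (Field.absoluteGaloisGroup K) (A m) ((p ^ M : ℕ) : ℤ)),
        (ε = 1 ∨ ε = -1) ∧
        IsOfFinAddOrder (Affine.Point.map (W' := W) (c : K →ₐ[ℚ] K) P - ε • P) ∧
        (∀ m, ∀ a ∈ A m, hτ.pointsMap W a ∈ A m) ∧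
        Pt 1 = toGeomPoints (W.baseChange K) P ∧
        (∀ m : ℕ, Squarefree m →
          (∀ q ∈ m.primeFactors, IsKolyvaginPrime N W K p q ∧ FrobEqFrobInfty W K (p ^ (M + k)) q) →
          (∃ B ∈ A m, hτ.pointsMap W (Pt m) =
            (ε * (-1) ^ m.primeFactors.card) • Pt m + ((p ^ M : ℕ) : ℤ) • B) ∧
          (∀ v : HeightOneSpectrum (𝓞 K), (m : 𝓞 K) ∉ v.asIdeal →
            kolyvaginClass (W.baseChange K) _ hdiv (hA m) (Pt m) (hPt m) ∈
              selmerLocalKer (W.baseChange K) (v.adicCompletion K) ((p ^ M : ℕ) : ℤ)) ∧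
          (∀ ℓ : ℕ, ℓ.Prime → ℓ ∣ m → ∀ v : HeightOneSpectrum (𝓞 K), (ℓ : 𝓞 K) ∈ v.asIdeal →
            ∀ a : ℕ, (((p : ℤ) ^ a) •
                kolyvaginClass (W.baseChange K) _ hdiv (hA m) (Pt m) (hPt m) ∈
                selmerLocalKer (W.baseChange K) (v.adicCompletion K) ((p ^ M : ℕ) : ℤ) ↔
              ((p : ℤ) ^ a) • kolyvaginClass (W.baseChange K) _ hdiv (hA (m / ℓ)) (Pt (m / ℓ))
                  (hPt (m / ℓ)) ∈
                (W.baseChange K).torsionLocalKer (v.adicCompletion K) ((p ^ M : ℕ) : ℤ)))))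
    (hR : ∀ {M : ℕ} (_hM : 1 ≤ M) {ℓ : ℕ} (hℓ : IsKolyvaginPrime N W K p ℓ),
      FrobEqFrobInfty W K (p ^ M) ℓ →
      ∃ (A : Type) (_ : AddCommGroup A)
        (e : geomTorsion (W.baseChange K) ((p ^ M : ℕ) : ℤ) →+
          geomTorsion (W.baseChange K) ((p ^ M : ℕ) : ℤ) →+ A),
        (∀ x, e x x = 0) ∧ (∀ x, (∀ y, e x y = 0) → x = 0) ∧
        ∀ s ∈ selmerGroup (W.baseChange K) ((p ^ M : ℕ) : ℤ),
          ∀ c' : galH1Torsion (W.baseChange K) ((p ^ M : ℕ) : ℤ),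
          (∀ v : HeightOneSpectrum (𝓞 K), (ℓ : 𝓞 K) ∉ v.asIdeal →
            c' ∈ selmerLocalKer (W.baseChange K) (v.adicCompletion K) ((p ^ M : ℕ) : ℤ)) →
          (∀ w : InfinitePlace K,
            c' ∈ selmerLocalKer (W.baseChange K) w.Completion ((p ^ M : ℕ) : ℤ)) →
          ∀ 𝔔 ∈ hℓ.place.primesAbove, ∀ F : Field.absoluteGaloisGroup K,
            IsArithFrobAt (𝓞 K) F 𝔔 →
            F ∈ torsionFixing (W.baseChange K) ((p ^ M : ℕ) : ℤ) →
            ∀ σ ∈ 𝔔.inertia (Field.absoluteGaloisGroup K),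
            e (h1Eval (W.baseChange K) ((p ^ M : ℕ) : ℤ) s F)
              (h1Eval (W.baseChange K) ((p ^ M : ℕ) : ℤ) c' σ) = 0) :
    ∀ d : (W.baseChange K).sha, (∃ j : ℕ, p ^ j • d = 0) → p ^ (2 * m) • d = 0 := by
  refine pow_smul_sha_primary_eq_zero_at_of_leavesM_shift (N := N) hK hnt hp hp2 hρ k hm
    Literature.NumberTheory.Automorphic.chebotarev_artinRep_holds (W.exists_weilPairing_holds p) ?_
  intro M hM hdiv c hc
  obtain ⟨ε, τ, hτ, A, hA, Pt, hPt, hε, h53, hAτ, hPt1, hm'⟩ := hpoints hM hdiv c hc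
  obtain ⟨cl, hc1, hcl⟩ := exists_leafA_of_points_shift (N := N) k hdiv c hτ ε A hA hAτ Pt hPt hPt1
    (fun m hm'' hk ↦ (hm' m hm'' hk).1) (fun m hm'' hk ↦ (hm' m hm'' hk).2.1)
    (fun m hm'' hk ↦ (hm' m hm'' hk).2.2)
  exact ⟨ε, cl, hε, h53, hc1, hcl, hdual_shift_of_kolyvaginReciprocityM_of_conductorNorm W hN hK hp
    hp2 hM k hc (fun hℓ hℓM ↦ hR hM hℓ hℓM)⟩

/-- **If `p ∤ y` in `E(K)` then `Ш(E/K)[p^∞] = 0`, from points read at depth-`(M+k)` Kolyvagin primes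
and (R)_M** — the case `m = 0` of the preceding theorem (Gross 1991 Prop. 2.1 (2)); the END-shape used by
S1 `stub_inert_unitIndex`. [cite: GrossLMS1991, Prop. 2.1 (2), §10] [cite: McCallumLMS1991, §1 Theorem (Kolyvagin)] -/
theorem sha_primary_eq_zero_at_of_pointsM_shift_of_reciprocityM_of_not_dvd_of_conductorNorm {N : ℕ}
    [NeZero N] (W : WeierstrassCurve ℚ) [W.IsElliptic] (hN : W.conductorNorm ℤ = N)
    (hK : IsImaginaryQuadratic K) {P : (W.baseChange K).toAffine.Point}
    (hnt : ¬ IsOfFinAddOrder P) {p : ℕ} (hp : p.Prime)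
    (hp2 : p ≠ 2) (hρ : W.HasSurjectiveModNGaloisRep p) (k : ℕ)
    (hndvd : ∀ Q : (W.baseChange K).toAffine.Point, p • Q ≠ P)
    (hpoints : ∀ {M : ℕ} (_hM : 1 ≤ M)
      (hdiv : ∀ Q : geomPoints (W.baseChange K), ∃ R, ((p ^ M : ℕ) : ℤ) • R = Q)
      (c : K ≃ₐ[ℚ] K) (_hc : c ≠ 1),
      ∃ (ε : ℤ) (τ : AlgebraicClosure K ≃+* AlgebraicClosure K) (hτ : IsLiftOfAut c τ)
        (A : ℕ → AddSubgroup (geomPoints (W.baseChange K)))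
        (hA : ∀ m, KolyvaginCocycle.IsAdmissible (Field.absoluteGaloisGroup K) (A m)
          ((p ^ M : ℕ) : ℤ))
        (Pt : ℕ → geomPoints (W.baseChange K))
        (hPt : ∀ m, Pt m ∈
          KolyvaginCocycle.invPoints (Field.absoluteGaloisGroup K) (A m) ((p ^ M : ℕ) : ℤ)),
        (ε = 1 ∨ ε = -1) ∧
        IsOfFinAddOrder (Affine.Point.map (W' := W) (c : K →ₐ[ℚ] K) P - ε • P) ∧
        (∀ m, ∀ a ∈ A m, hτ.pointsMap W a ∈ A m) ∧
        Pt 1 = toGeomPoints (W.baseChange K) P ∧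
        (∀ m : ℕ, Squarefree m →
          (∀ q ∈ m.primeFactors, IsKolyvaginPrime N W K p q ∧ FrobEqFrobInfty W K (p ^ (M + k)) q) →
          (∃ B ∈ A m, hτ.pointsMap W (Pt m) =
            (ε * (-1) ^ m.primeFactors.card) • Pt m + ((p ^ M : ℕ) : ℤ) • B) ∧
          (∀ v : HeightOneSpectrum (𝓞 K), (m : 𝓞 K) ∉ v.asIdeal →
            kolyvaginClass (W.baseChange K) _ hdiv (hA m) (Pt m) (hPt m) ∈
              selmerLocalKer (W.baseChange K) (v.adicCompletion K) ((p ^ M : ℕ) : ℤ)) ∧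
          (∀ ℓ : ℕ, ℓ.Prime → ℓ ∣ m → ∀ v : HeightOneSpectrum (𝓞 K), (ℓ : 𝓞 K) ∈ v.asIdeal →
            ∀ a : ℕ, (((p : ℤ) ^ a) •
                kolyvaginClass (W.baseChange K) _ hdiv (hA m) (Pt m) (hPt m) ∈
                selmerLocalKer (W.baseChange K) (v.adicCompletion K) ((p ^ M : ℕ) : ℤ) ↔
              ((p : ℤ) ^ a) • kolyvaginClass (W.baseChange K) _ hdiv (hA (m / ℓ)) (Pt (m / ℓ))
                  (hPt (m / ℓ)) ∈
                (W.baseChange K).torsionLocalKer (v.adicCompletion K) ((p ^ M : ℕ) : ℤ)))))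
    (hR : ∀ {M : ℕ} (_hM : 1 ≤ M) {ℓ : ℕ} (hℓ : IsKolyvaginPrime N W K p ℓ),
      FrobEqFrobInfty W K (p ^ M) ℓ →
      ∃ (A : Type) (_ : AddCommGroup A)
        (e : geomTorsion (W.baseChange K) ((p ^ M : ℕ) : ℤ) →+
          geomTorsion (W.baseChange K) ((p ^ M : ℕ) : ℤ) →+ A),
        (∀ x, e x x = 0) ∧ (∀ x, (∀ y, e x y = 0) → x = 0) ∧
        ∀ s ∈ selmerGroup (W.baseChange K) ((p ^ M : ℕ) : ℤ),
          ∀ c' : galH1Torsion (W.baseChange K) ((p ^ M : ℕ) : ℤ),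
          (∀ v : HeightOneSpectrum (𝓞 K), (ℓ : 𝓞 K) ∉ v.asIdeal →
            c' ∈ selmerLocalKer (W.baseChange K) (v.adicCompletion K) ((p ^ M : ℕ) : ℤ)) →
          (∀ w : InfinitePlace K,
            c' ∈ selmerLocalKer (W.baseChange K) w.Completion ((p ^ M : ℕ) : ℤ)) →
          ∀ 𝔔 ∈ hℓ.place.primesAbove, ∀ F : Field.absoluteGaloisGroup K,
            IsArithFrobAt (𝓞 K) F 𝔔 →
            F ∈ torsionFixing (W.baseChange K) ((p ^ M : ℕ) : ℤ) →
            ∀ σ ∈ 𝔔.inertia (Field.absoluteGaloisGroup K),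
            e (h1Eval (W.baseChange K) ((p ^ M : ℕ) : ℤ) s F)
              (h1Eval (W.baseChange K) ((p ^ M : ℕ) : ℤ) c' σ) = 0) :
    ∀ d : (W.baseChange K).sha, (∃ j : ℕ, p ^ j • d = 0) → d = 0 := by
  intro d hd
  have h := pow_smul_sha_primary_eq_zero_at_of_pointsM_shift_of_reciprocityM_of_conductorNorm W hN hK
    hnt hp hp2 hρ (m := 0) k (fun Q ↦ by simpa using hndvd Q) hpoints hR d hd
  simpa using h

end Entry

end Summit.BirchSwinnertonDyer.BirchSwinnertonDyer.Theorems

end
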